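import Summits.ValiantsHypothesis.ValiantsHypothesis.Theorems.BarrierLeverGradientGenericFibreCountMReg

/-!
# Route BarrierLever — item `GradientGenericFibreCount` (stmt-ValiantsHypothesis-19256),
# part 5/6: the Jacobian/Kähler radicality criterion and the weak-Nullstellensatz unit criterion

Route J of the cell memo (ROUTE-MEMO-p2-g4 §4b), first half — pure commutative algebra over `ℂ`:

* `derivation_apply_eq_sum` — a derivation on `R[x_1, …, x_k]` is determined by the partials,
  `D p = Σ_i ∂_i p • D(x_i)`;
* `isRadical_of_isUnit_jacobian` (**J-d**) — if the Jacobian determinant of a square system `G`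
  is a unit modulo `(G)`, then `Ω_{(ℂ[x]/(G))/ℂ} = 0`, so `ℂ[x]/(G)` is formally unramified over
  the field `ℂ`, hence reduced (Mathlib `Algebra.FormallyUnramified.isReduced_of_field`), i.e.
  `(G)` is radical;
* `exists_zero_of_ne_top`, `isUnit_mk_of_forall_eval_ne_zero` (**J-e**) — weak Nullstellensatz: an
  element of `ℂ[x]` vanishing at no point of `V(I)` is a unit modulo `I`;
* `algebraicIndependent_of_surjective` (**J-a**) — a polynomial self-map of `ℂᵏ` with all fibres
  non-empty has algebraically independent components.

Part 6/6 (`…GradientGenericFibreCount.lean`) combines these with finiteness of `ℂ[x]` over `ℂ[F]`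
into `genericRadical_holds : GenericRadical` and the item.

Lean text authored by the cell planner seat `valiant-natproofs-p2` (gen 4, HOME/HBasis-p2g4.lean,
1431 lines, kernel-checked rc 0 / 0 sorries; referee REF-G12 §4 and REF-G13 §2 PASS incl. full
line-read), ported by the prover seats (namespace `…Theorems.BarrierLever.HBasis`, six files, split
only; parts 1–4 by the `valiant-natproofs-prover` seat, parts 5–6 by `val-np-p1`).

WHAT THIS IS NOT: nothing here touches FSV Question 6 / crux stmt-14610 or `VP` vs `VNP`; the item
is the algebro-geometric half of `NaturalProofsAgainstAllLinearSizes` (stmt-20156), whose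
complexity half is `NaturalProofsAgainstAllLinearSizesOfCount` (stmt-19261).

References: [CoxLittleOSheaUsing2005] Ch. 3 Thm. (5.5); Hartshorne III Cor. 10.7 (generic
smoothness, replaced here by the Jacobian/Kähler argument); Mathlib `KaehlerDifferential`,
`Algebra.FormallyUnramified`.
-/

-- layout Summits/ValiantsHypothesis/ValiantsHypothesis forces the duplicated namespace component
set_option linter.dupNamespace false

open MvPolynomial Finset

namespace Summit.ValiantsHypothesis.ValiantsHypothesis.Theorems.BarrierLever.HBasis

/-! ## Towards the stub `GenericRadical` (route J of the memo: Jacobian criterion + Kähler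
differentials)

`J-d`: if the Jacobian determinant of a square system `G` is a unit modulo `(G)`, then `(G)` is
radical (`Ω_{A/ℂ} = 0` ⇒ formally unramified ⇒ reduced, Mathlib
`Algebra.FormallyUnramified.isReduced_of_field`). -/

section GenericRadicalWork

open Module

/-- Any derivation on a polynomial ring in finitely many variables is determined by the partial
derivatives: `D p = Σ_i ∂_i p • D(X_i)`. -/
theorem derivation_apply_eq_sum {R : Type*} [CommRing R] {τ : Type*} [Fintype τ] [DecidableEq τ]
    {M : Type*} [AddCommGroup M] [Module (MvPolynomial τ R) M] [Module R M]
    [IsScalarTower R (MvPolynomial τ R) M]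
    (D : Derivation R (MvPolynomial τ R) M) (p : MvPolynomial τ R) :
    D p = ∑ i, pderiv i p • D (X i) := by
  let L : MvPolynomial τ R →ₗ[R] M :=
    { toFun := fun p => ∑ i, pderiv i p • D (X i)
      map_add' := fun p q => by
        simp only [map_add, add_smul, Finset.sum_add_distrib]
      map_smul' := fun r p => by
        simp only [(pderiv _).map_smul, smul_assoc, RingHom.id_apply, Finset.smul_sum] }
  let D' : Derivation R (MvPolynomial τ R) M := Derivation.mk' L fun p q => by
    simp only [L, LinearMap.coe_mk, AddHom.coe_mk, Derivation.leibniz, add_smul, smul_eq_mul,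
      mul_smul, Finset.sum_add_distrib, Finset.smul_sum]
  have hDD' : D = D' := by
    refine MvPolynomial.derivation_ext fun i => ?_
    show D (X i) = ∑ j, pderiv j (X i : MvPolynomial τ R) • D (X j)
    simp_rw [pderiv_X, Pi.single_apply, ite_smul, one_smul, zero_smul]
    rw [Finset.sum_ite_eq Finset.univ i]
    simp
  conv_lhs => rw [hDD']
  rfl

/-- **J-d.** If the Jacobian determinant of `G_1, …, G_k ∈ ℂ[x_1, …, x_k]` is a unit modulo `(G)`,
then the ideal `(G)` is radical. -/
theorem isRadical_of_isUnit_jacobian {k : ℕ} (G : Fin k → MvPolynomial (Fin k) ℂ)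
    (hunit : IsUnit (Ideal.Quotient.mk (Ideal.span (Set.range G))
      (Matrix.det (Matrix.of fun j i => pderiv i (G j))))) :
    (Ideal.span (Set.range G)).IsRadical := by
  classical
  set I : Ideal (MvPolynomial (Fin k) ℂ) := Ideal.span (Set.range G) with hI_def
  set π : MvPolynomial (Fin k) ℂ →+* MvPolynomial (Fin k) ℂ ⧸ I := Ideal.Quotient.mk I with hπ
  -- the Jacobian matrix over `A = S/I` and its inverse
  set Jb : Matrix (Fin k) (Fin k) (MvPolynomial (Fin k) ℂ ⧸ I) :=
    π.mapMatrix (Matrix.of fun j i => pderiv i (G j)) with hJb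
  have hJb_apply : ∀ j i, Jb j i = π (pderiv i (G j)) := fun j i => rfl
  have hdet : IsUnit Jb.det := by
    have : Jb.det = π (Matrix.det (Matrix.of fun j i => pderiv i (G j))) :=
      (RingHom.map_det π _).symm
    rw [this]; exact hunit
  -- Step 1: `Ω[A/ℂ] = 0`
  haveI hfu : Algebra.FormallyUnramified ℂ (MvPolynomial (Fin k) ℂ ⧸ I) := by
    refine ⟨?_⟩
    set D := KaehlerDifferential.D ℂ (MvPolynomial (Fin k) ℂ ⧸ I) with hD
    let DS : Derivation ℂ (MvPolynomial (Fin k) ℂ) (Ω[(MvPolynomial (Fin k) ℂ ⧸ I)⁄ℂ]) :=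
      D.compAlgebraMap (MvPolynomial (Fin k) ℂ)
    have hDS : ∀ p, DS p = D (π p) := fun p => rfl
    have hsmul : ∀ (p : MvPolynomial (Fin k) ℂ) (ω : Ω[(MvPolynomial (Fin k) ℂ ⧸ I)⁄ℂ]),
        p • ω = π p • ω := by
      intro p ω
      rw [← algebraMap_smul (A := MvPolynomial (Fin k) ℂ ⧸ I) p ω]
      rfl
    -- the relations `Σ_i π(∂_i G_j) • D(x̄_i) = 0`
    have hrel : ∀ j, ∑ i, Jb j i • D (π (X i)) = 0 := by
      intro j
      have h0 : DS (G j) = 0 := by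
        rw [hDS, Ideal.Quotient.eq_zero_iff_mem.2 (Ideal.subset_span (Set.mem_range_self j)),
          map_zero]
      rw [derivation_apply_eq_sum DS (G j)] at h0
      simp_rw [hsmul, hDS] at h0
      simp_rw [hJb_apply]
      exact h0
    have hD0 : ∀ l, D (π (X l)) = 0 := by
      intro l
      set Jinv : Matrix (Fin k) (Fin k) (MvPolynomial (Fin k) ℂ ⧸ I) := Jb⁻¹ with hJinv
      have hmul : Jinv * Jb = 1 := Matrix.nonsing_inv_mul _ hdet
      have h1 : D (π (X l)) = ∑ i, (Jinv * Jb) l i • D (π (X i)) := by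
        rw [hmul]
        simp only [Matrix.one_apply, ite_smul, one_smul]
        have hsingle : (∑ x : Fin k, if l = x then D (π (X x)) else
            (0 : MvPolynomial (Fin k) ℂ ⧸ I) • D (π (X x))) = D (π (X l)) := by
          rw [Finset.sum_eq_single l, if_pos rfl]
          · intro b _ hb
            rw [if_neg (Ne.symm hb)]
            exact zero_smul (MvPolynomial (Fin k) ℂ ⧸ I) (D (π (X b)))
          · intro h; exact absurd (Finset.mem_univ l) h
        exact hsingle.symm
      have h2 : ∀ i, (Jinv * Jb) l i • D (π (X i)) = ∑ j, Jinv l j • (Jb j i • D (π (X i))) := by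
        intro i
        rw [Matrix.mul_apply, Finset.sum_smul]
        exact Finset.sum_congr rfl fun j _ => mul_smul _ _ _
      rw [h1, Finset.sum_congr rfl fun i _ => h2 i, Finset.sum_comm]
      refine Finset.sum_eq_zero fun j _ => ?_
      rw [← Finset.smul_sum, hrel j, smul_zero]
    have hDall : ∀ a : MvPolynomial (Fin k) ℂ ⧸ I, D a = 0 := by
      intro a
      obtain ⟨p, rfl⟩ := Ideal.Quotient.mk_surjective a
      show D (π p) = 0
      rw [← hDS, derivation_apply_eq_sum DS p]
      simp_rw [hDS, hD0, smul_zero, Finset.sum_const_zero]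
    have htop := KaehlerDifferential.span_range_derivation ℂ (MvPolynomial (Fin k) ℂ ⧸ I)
    rw [← hD] at htop
    have hrange : Set.range (D : (MvPolynomial (Fin k) ℂ ⧸ I) →
        Ω[(MvPolynomial (Fin k) ℂ ⧸ I)⁄ℂ]) = {0} := by
      ext ω
      simp only [Set.mem_range, Set.mem_singleton_iff]
      exact ⟨fun ⟨a, ha⟩ => ha ▸ hDall a, fun h => ⟨0, by rw [h, map_zero]⟩⟩
    refine subsingleton_of_forall_eq 0 fun ω => ?_
    have hω : ω ∈ Submodule.span (MvPolynomial (Fin k) ℂ ⧸ I)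
        (Set.range (D : (MvPolynomial (Fin k) ℂ ⧸ I) → Ω[(MvPolynomial (Fin k) ℂ ⧸ I)⁄ℂ])) := by
      rw [htop]; exact Submodule.mem_top
    rw [hrange, Submodule.span_zero_singleton] at hω
    exact (Submodule.mem_bot _).1 hω
  -- Step 2: formally unramified over a field ⇒ reduced
  haveI : Algebra.FiniteType ℂ (MvPolynomial (Fin k) ℂ ⧸ I) :=
    Algebra.FiniteType.of_surjective (Ideal.Quotient.mkₐ ℂ I) (Ideal.Quotient.mkₐ_surjective ℂ I)
  haveI : IsReduced (MvPolynomial (Fin k) ℂ ⧸ I) :=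
    Algebra.FormallyUnramified.isReduced_of_field ℂ (MvPolynomial (Fin k) ℂ ⧸ I)
  exact (Ideal.isRadical_iff_quotient_reduced I).2 this

/-- A proper ideal of `ℂ[x_1, …, x_k]` has a zero (weak Nullstellensatz). -/
theorem exists_zero_of_ne_top {k : ℕ} {I : Ideal (MvPolynomial (Fin k) ℂ)} (hI : I ≠ ⊤) :
    ∃ v : Fin k → ℂ, ∀ p ∈ I, eval v p = 0 := by
  obtain ⟨M, hM, hIM⟩ := Ideal.exists_le_maximal I hI
  obtain ⟨v, hv⟩ := (MvPolynomial.isMaximal_iff_eq_vanishingIdeal_singleton (I := M)).1 hM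
  refine ⟨v, fun p hp => ?_⟩
  have h := hIM hp
  rw [hv, MvPolynomial.mem_vanishingIdeal_iff] at h
  exact h v rfl

/-- **J-e.** An element of `ℂ[x]` vanishing at no point of `V(I)` is a unit modulo `I`. -/
theorem isUnit_mk_of_forall_eval_ne_zero {k : ℕ} {I : Ideal (MvPolynomial (Fin k) ℂ)}
    {a : MvPolynomial (Fin k) ℂ}
    (ha : ∀ v : Fin k → ℂ, (∀ p ∈ I, eval v p = 0) → eval v a ≠ 0) :
    IsUnit (Ideal.Quotient.mk I a) := by
  by_contra hna
  have hne : I ⊔ Ideal.span {a} ≠ ⊤ := by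
    intro htop
    apply hna
    have h1 : (1 : MvPolynomial (Fin k) ℂ) ∈ I ⊔ Ideal.span {a} := htop ▸ Submodule.mem_top
    obtain ⟨i, hi, b, hb, hib⟩ := Submodule.mem_sup.1 h1
    obtain ⟨r, rfl⟩ := Ideal.mem_span_singleton'.1 hb
    have hra : r * a = 1 - i := by rw [← hib]; ring
    refine IsUnit.of_mul_eq_one (Ideal.Quotient.mk I r) ?_
    rw [← map_mul, mul_comm, hra, map_sub, map_one, Ideal.Quotient.eq_zero_iff_mem.2 hi, sub_zero]
  obtain ⟨v, hv⟩ := exists_zero_of_ne_top hne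
  refine ha v (fun p hp => hv p (Ideal.mem_sup_left hp)) ?_
  exact hv a (Ideal.mem_sup_right (Ideal.mem_span_singleton_self a))

/-- **J-a.** A polynomial map `ℂᵏ → ℂᵏ` all of whose fibres are non-empty has algebraically
independent components. -/
theorem algebraicIndependent_of_surjective {k : ℕ} (F : Fin k → MvPolynomial (Fin k) ℂ)
    (hsurj : ∀ c : Fin k → ℂ, ∃ x : Fin k → ℂ, ∀ i, eval x (F i) = c i) :
    AlgebraicIndependent ℂ F := by
  rw [algebraicIndependent_iff_injective_aeval]
  refine (injective_iff_map_eq_zero _).2 fun P hP => ?_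
  apply MvPolynomial.funext
  intro c
  obtain ⟨x, hx⟩ := hsurj c
  rw [map_zero]
  have h := congr_arg (MvPolynomial.aeval x) hP
  rw [map_zero, ← AlgHom.comp_apply, MvPolynomial.comp_aeval] at h
  have hfun : (fun i => MvPolynomial.aeval x (F i)) = c := funext fun i => hx i
  rw [hfun] at h
  exact h

end GenericRadicalWork

end Summit.ValiantsHypothesis.ValiantsHypothesis.Theorems.BarrierLever.HBasis
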